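import Summits.BirchSwinnertonDyer.BirchSwinnertonDyer.Theorems.BiquadraticEisensteinDescentHeegnerTwistCouplingInSupplyEpCellTwoIsogeny
import Summits.BirchSwinnertonDyer.BirchSwinnertonDyer.Theorems.BiquadraticEisensteinDescentHeegnerTwistCouplingInSupplyQuarticCell
import Summits.BirchSwinnertonDyer.BirchSwinnertonDyer.Theorems.BiquadraticEisensteinDescentHeegnerTwistCouplingInSupplyCornersThreeFacts
import Literature.NumberTheory.EllipticCurves.LiLiuTian2024.CongruentNumberFullBSD
import Literature.NumberTheory.EllipticCurves.CongruentNumberCurveLSeriesProofs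
import Literature.NumberTheory.EllipticCurves.Kriz2020.GoldfeldJ1728Proofs
import Literature.NumberTheory.EllipticCurves.BSDSelmerCMPConverse
import Literature.NumberTheory.EllipticCurves.AnalyticRankOrderProofs
import HarnessLib

set_option linter.dupNamespace false -- `Summit.BirchSwinnertonDyer.BirchSwinnertonDyer.Theorems.…` (summit = sub)
set_option autoImplicit false

/-!
# Crux `HeegnerTwistCouplingInSupply` (stmt-BirchSwinnertonDyer-21381) — ★★ the corner `W = E_p` (63/64 of the primes `p ≡ 7 (mod 8)`)
# modulo Burungale–Tian ONLY: Monsky's matrix theorem and Burungale–Flach removed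

Route `BiquadraticEisensteinDescent` (cell `pub/bsd-wall`, width seat `bsd-wall-cm-bed-w3` g12; `--supports` 21381, helper). The corner
theorem `…CornersThreeFacts.cruxOnEpCorner_of_three_facts` (w4 g12 after the lead `bsd-line-ibd-p1` g10/g11) gives, for every prime
`p ≡ 7 (mod 8)` in the partner-ladder classes, a Heegner field `K′ = ℚ(√−ql)` of `N(E_p)` with `L(E_p^{(d_{K′})}, 1) ≠ 0`, `h(K′) < p` — modulo
THREE named facts: Monsky's `2`-descent matrix theorem (`monsky_card_selmerGroup_two_odd`, Heath-Brown 1994 appendix), Burungale–Tian's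
rank-zero `2`-converse, and Burungale–Flach (the last only to state the BSD triple alongside). The `L`-half needs only `r_an(E_{pql}) = 0`,
and the cell `(p, q, l)` is sharp for the PLAIN `2`-isogeny descent PROVED in the tree (`…EpCellTwoIsogeny`: `S(0,−n²) ⊆ {±1,±n}`,
`S(0, 4n²) ⊆ {1}`, `n = pql`). Hence:

* §1 ★ `rank_eq_zero_and_sha_two_congruent` — **`rank E_{pql}(ℚ) = 0` and `Ш(E_{pql}/ℚ)[2] = 0`** in the cell, UNCONDITIONAL
  (`two_pow_twoIsogenySelmerRank_add_eq`, AEC X.4.2(a): `#S·#S′ ≤ 4 = 2^{rank+2}·#Ш′[φ̂]·#Ш[φ]`; `forall_mem_sha_two_smul_eq_zero_of_halfModel`);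
  ★ `selmerCorank_two_congruent_eq_zero` — **`corank_{ℤ₂} Sel_{2^∞}(E_{pql}/ℚ) = 0`**; ★ `L_one_ne_zero_congruent` — `r_an = 0` and
  `L(E_{pql}, 1) ≠ 0` modulo Burungale–Tian ONLY (`HasCM` = `LiLiuTian2024.hasCM_congruentNumberCurve`, continuation =
  `hasEntireLFunction_congruentNumberCurve_holds`, both tree theorems);
* §2 ★★ `cruxOnEpCorner_of_BT` — the statement of `cruxOnEpCorner_of_three_facts` VERBATIM with the hypotheses `hM` (Monsky) and `hBF`
  (Burungale–Flach) deleted: for every prime `p ≡ 7 (mod 8)` with `p ≡ 2 (mod 3)` or `p ≡ ±2 (mod 5)` or `(p/11) = −1` or `(p/19) = −1` or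
  `(p/43) = −1` or `(13/p) = −1`, a Heegner field `K′` of `N(E_p)` with `4 < |d_{K′}|`, `L(E_p^{(d_{K′})}, 1) ≠ 0`, `h(K′) < p`, `p ∤ h(K′)` —
  modulo Burungale–Tian 2026 Thm 1.1 ONLY (cell data `exists_cellData_p`, field `exists_witnessField_of`, support of `N(E_p)`
  `eq_two_or_eq_of_prime_dvd_conductorNorm_p` by name).

PARI (kit j315629): the `E_{2p}` cell A is NOT sharp for plain `2`-isogeny descent (`#S(0,−n²) = 16`), so `cruxOnE2pCorner_of_three_facts`
keeps its Monsky input. HONEST FRAMING: a typed sub-corner on one CM family; the crux (all CM `W` of analytic rank one; residual C⁺) is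
untouched; BSD is not proved by any of this. THEOREMS ONLY; supports stmt-BirchSwinnertonDyer-21381.
-/

noncomputable section

open scoped Classical

namespace Summit.BirchSwinnertonDyer.BirchSwinnertonDyer.Theorems.BiquadraticEisensteinDescentHeegnerTwistCouplingInSupplyCornersEpOneFact

open _root_.WeierstrassCurve Literature.NumberTheory.EllipticCurves
open Summit.BirchSwinnertonDyer.BirchSwinnertonDyer.Theorems.GoldfeldGoodTwists (mordellWeilRank_congr forall_mem_sha_two_congr)
open Summit.BirchSwinnertonDyer.BirchSwinnertonDyer.Theorems.BiquadraticEisensteinDescentHeegnerTwistCouplingInSupplyQuarticCellPhiHat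
  (q_ne_p l_ne_p)
open Summit.BirchSwinnertonDyer.BirchSwinnertonDyer.Theorems.BiquadraticEisensteinDescentHeegnerTwistCouplingInSupplyQuarticCell
  (twoIsogenySelmerGroup'_zero)
open Summit.BirchSwinnertonDyer.BirchSwinnertonDyer.Theorems.BiquadraticEisensteinDescentHeegnerTwistCouplingInSupplyEpCellTwoIsogeny
open Summit.BirchSwinnertonDyer.BirchSwinnertonDyer.Theorems.BiquadraticEisensteinDescentHeegnerTwistCouplingInSupplyPartnerLadder
  (exists_witnessField_of jacobiSym_neg_mul_eq_one)
open Summit.BirchSwinnertonDyer.BirchSwinnertonDyer.Theorems.BiquadraticEisensteinDescentHeegnerTwistCouplingInSupplyCornersThreeFacts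
  (exists_cellData_p eq_two_or_eq_of_prime_dvd_conductorNorm_p)

/-! ## §1 `E_{pql}` in the cell: rank `0`, `Ш[2] = 0`, corank `0`, `L(1) ≠ 0` -/

section Cell

variable {p q l : ℕ}

/-- Arithmetic core: `m = 2^{r+2} (n₁ n₂) ≤ 4`, `m > 0` ⇒ `r = 0` and `n₁ = n₂ = 1`. [folklore] -/
private theorem core_arith {r n₁ n₂ m : ℕ} (hm : m = 2 ^ (r + 2) * (n₁ * n₂)) (hm4 : m ≤ 4) (hmpos : 0 < m) :
    r = 0 ∧ n₁ = 1 ∧ n₂ = 1 := by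
  subst hm
  have hn₁ : 0 < n₁ := Nat.pos_of_ne_zero (by rintro rfl; simp at hmpos)
  have hn₂ : 0 < n₂ := Nat.pos_of_ne_zero (by rintro rfl; simp at hmpos)
  have h2 : 2 ^ (r + 2) ≤ 4 := le_trans (Nat.le_mul_of_pos_right _ (Nat.mul_pos hn₁ hn₂)) hm4
  have hr : r = 0 := by
    by_contra hr
    have h8 : 2 ^ 3 ≤ 2 ^ (r + 2) := Nat.pow_le_pow_right (by norm_num) (by omega)
    omega
  subst hr
  norm_num at hm4
  refine ⟨rfl, ?_, ?_⟩ <;> nlinarith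

/-- The tree's cast literal `E_{0, −n²}` is the congruent number curve `E_n`. [folklore] -/
theorem lit_congruent (n : ℕ) :
    (⟨0, ((0 : ℤ) : ℚ), 0, ((-(((n : ℕ) : ℤ) ^ 2) : ℤ) : ℚ), 0⟩ : WeierstrassCurve ℚ) = congruentNumberCurve n := by
  ext <;> simp [congruentNumberCurve]

/-- ★ **`rank E_{pql}(ℚ) = 0` and `Ш(E_{pql}/ℚ)[2] = 0`** in the cell (`p ≡ 7 (mod 8)`, `q ≡ 3 (mod 8)`, `(q/p) = +1`, `l ≡ 5 (mod 8)`,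
`(l/p) = −1`) — UNCONDITIONAL, by plain `2`-isogeny descent (no Monsky): `#S(0,−n²) ≤ 4`, `#S(0,4n²) ≤ 1` and the counted Kummer sequences.
[cite: SilvermanAEC2009, Thm. X.4.2(a) and Prop. X.4.9] -/
theorem rank_eq_zero_and_sha_two_congruent (hp : p.Prime) (hq : q.Prime) (hl : l.Prime) (hp8 : p % 8 = 7) (hq8 : q % 8 = 3)
    (hl8 : l % 8 = 5) (hJq : jacobiSym (q : ℤ) p = 1) (hJl : jacobiSym (l : ℤ) p = -1) [(congruentNumberCurve (p * q * l)).IsElliptic] :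
    (congruentNumberCurve (p * q * l)).mordellWeilRank = 0 ∧ ∀ c ∈ (congruentNumberCurve (p * q * l)).sha, 2 • c = 0 → c = 0 := by
  set n : ℕ := p * q * l with hn
  have hn0 : ((n : ℕ) : ℤ) ≠ 0 := by exact_mod_cast Nat.mul_ne_zero (Nat.mul_ne_zero hp.ne_zero hq.ne_zero) hl.ne_zero
  set B : ℤ := -(((n : ℕ) : ℤ) ^ 2) with hB
  have hab : B * ((0 : ℤ) ^ 2 - 4 * B) ≠ 0 := by
    rw [hB, show -(((n : ℕ) : ℤ) ^ 2) * ((0 : ℤ) ^ 2 - 4 * -(((n : ℕ) : ℤ) ^ 2)) = -4 * (((n : ℕ) : ℤ) ^ 2) ^ 2 by ring]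
    exact mul_ne_zero (by norm_num) (pow_ne_zero 2 (pow_ne_zero 2 hn0))
  haveI := isElliptic_halfModel hab
  haveI := isElliptic_mk_of_ne_zero (F := ℚ) hab
  have key := two_pow_twoIsogenySelmerRank_add_eq hab
  have hS : (twoIsogenySelmerGroup 0 B).card ≤ 4 :=
    le_trans (Finset.card_le_card fun d hd => by
      have := mem_twoIsogenySelmerGroup_neg_sq hp hq hl hp8 hq8 hl8 hJq hJl hd
      simp only [Finset.mem_insert, Finset.mem_singleton]
      exact this) Finset.card_le_four
  have hS' : (twoIsogenySelmerGroup' 0 B).card ≤ 1 := by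
    rw [twoIsogenySelmerGroup'_zero, show -4 * B = 4 * ((n : ℕ) : ℤ) ^ 2 by rw [hB]; ring]
    exact le_trans (Finset.card_le_card fun d hd => by
      rw [Finset.mem_singleton]
      exact mem_twoIsogenySelmerGroup_four_sq hp hq hl hp8 hq8 hl8 hJq hJl hd) (by simp)
  have h4 : 2 ^ (twoIsogenySelmerRank 0 B + twoIsogenySelmerRank' 0 B) ≤ 4 := by
    rw [pow_add, two_pow_twoIsogenySelmerRank_eq_card hab, two_pow_twoIsogenySelmerRank'_eq_card hab]
    calc (twoIsogenySelmerGroup 0 B).card * (twoIsogenySelmerGroup' 0 B).card ≤ 4 * 1 := Nat.mul_le_mul hS hS'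
      _ = 4 := by norm_num
  obtain ⟨hr, h₁, h₂⟩ := core_arith key h4 (pow_pos two_pos _)
  have hsha := forall_mem_sha_two_smul_eq_zero_of_halfModel (AddSubgroup.eq_bot_of_card_eq _ h₁) (AddSubgroup.eq_bot_of_card_eq _ h₂)
  have hlit : (⟨0, ((0 : ℤ) : ℚ), 0, (B : ℚ), 0⟩ : WeierstrassCurve ℚ) = congruentNumberCurve n := by rw [hB]; exact lit_congruent n
  refine ⟨?_, forall_mem_sha_two_congr hlit.symm hsha⟩
  rw [← mordellWeilRank_congr hlit]
  exact hr

/-- ★ **`corank_{ℤ₂} Sel_{2^∞}(E_{pql}/ℚ) = 0`** in the cell (Greenberg's identity with `rank = 0`, `Ш[2] = 0`) — the hypothesis of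
Burungale–Tian's rank-zero `2`-converse. [cite: SilvermanAEC2009, Thm. X.4.2(a) and Prop. X.4.9] [cite: Greenberg1999, §1] -/
theorem selmerCorank_two_congruent_eq_zero (hp : p.Prime) (hq : q.Prime) (hl : l.Prime) (hp8 : p % 8 = 7) (hq8 : q % 8 = 3)
    (hl8 : l % 8 = 5) (hJq : jacobiSym (q : ℤ) p = 1) (hJl : jacobiSym (l : ℤ) p = -1) [(congruentNumberCurve (p * q * l)).IsElliptic] :
    (congruentNumberCurve (p * q * l)).selmerCorank 2 = 0 := by
  haveI : Fact (Nat.Prime 2) := ⟨Nat.prime_two⟩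
  obtain ⟨hr, hsha⟩ := rank_eq_zero_and_sha_two_congruent hp hq hl hp8 hq8 hl8 hJq hJl
  rw [(congruentNumberCurve (p * q * l)).selmerCorank_eq_mordellWeilRank_add_holds 2, hr,
    (congruentNumberCurve (p * q * l)).shaCorank_eq_zero_of_forall 2 hsha]

/-- `p q l` is square-free for distinct primes. [folklore] -/
theorem squarefree_pql (hp : p.Prime) (hq : q.Prime) (hl : l.Prime) (hqp : q ≠ p) (hlp : l ≠ p) (hql : q ≠ l) : Squarefree (p * q * l) := by
  rw [Nat.squarefree_mul (Nat.Coprime.mul_left ((Nat.coprime_primes hp hl).mpr hlp.symm) ((Nat.coprime_primes hq hl).mpr hql)),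
    Nat.squarefree_mul ((Nat.coprime_primes hp hq).mpr hqp.symm)]
  exact ⟨⟨hp.squarefree, hq.squarefree⟩, hl.squarefree⟩

/-- ★ **`r_an(E_{pql}) = 0` and `L(E_{pql}, 1) ≠ 0` in the cell, modulo Burungale–Tian ONLY**: the corank vanishes unconditionally, `E_n` has
CM (`LiLiuTian2024.hasCM_congruentNumberCurve`), the rank-zero `2`-converse gives `r_an = 0`, and `L(E_n, s)` is entire by the tree theorem
`hasEntireLFunction_congruentNumberCurve_holds`, so `r_an = 0` reads `L(1) ≠ 0`. [cite: BurungaleTian2026, Thm. 1.1] [cite: KoblitzECMF1993, Ch. II §5, Theorem] -/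
theorem L_one_ne_zero_congruent (hBT : burungaleTian_analyticRank_eq_zero_of_selmerCorank_eq_zero_of_hasCM) (hp : p.Prime) (hq : q.Prime)
    (hl : l.Prime) (hp8 : p % 8 = 7) (hq8 : q % 8 = 3) (hl8 : l % 8 = 5) (hJq : jacobiSym (q : ℤ) p = 1) (hJl : jacobiSym (l : ℤ) p = -1)
    [(congruentNumberCurve (p * q * l)).IsElliptic] :
    (congruentNumberCurve (p * q * l)).analyticRank = 0 ∧ (congruentNumberCurve (p * q * l)).entireLFunction 1 ≠ 0 := by
  haveI : Fact (Nat.Prime 2) := ⟨Nat.prime_two⟩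
  have hsq : Squarefree (p * q * l) := squarefree_pql hp hq hl (q_ne_p hq hJq) (l_ne_p hl hJl) (by omega)
  have h0 := hBT (congruentNumberCurve (p * q * l)) (LiLiuTian2024.hasCM_congruentNumberCurve _) 2
    (selmerCorank_two_congruent_eq_zero hp hq hl hp8 hq8 hl8 hJq hJl)
  exact ⟨h0, (analyticRank_eq_zero_iff_holds (W := congruentNumberCurve (p * q * l))
    (hasEntireLFunction_congruentNumberCurve_holds hsq)).1 h0⟩

end Cell

/-! ## §2 ★★ The corner `W = E_p` modulo Burungale–Tian only -/

section Corner

/-- ★★ **THE CORNER `W = E_p`, partners `{3, 5, 11, 13, 19, 43}`, ONE NAMED FACT**: for every prime `p ≡ 7 (mod 8)` with `p ≡ 2 (mod 3)`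
or `p ≡ ±2 (mod 5)` or `(p/11) = −1` or `(p/19) = −1` or `(p/43) = −1` or `(13/p) = −1` — modulo Burungale–Tian ONLY — a Heegner field `K′` of
`N(E_p)` with `4 < |d_{K′}|`, `L(E_p^{(d_{K′})}, 1) ≠ 0`, `h(K′) < p`, `p ∤ h(K′)`. Same statement as
`…CornersThreeFacts.cruxOnEpCorner_of_three_facts` with Monsky's matrix theorem and Burungale–Flach REMOVED (the `2`-descent of `E_{pql}` is the
tree's plain `2`-isogeny descent, `…EpCellTwoIsogeny`). [cite: BurungaleTian2026, Thm. 1.1] [cite: SilvermanAEC2009, Prop. X.4.9 and Thm. X.4.2(a)]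
[cite: Oesterle1988Gauss, II §3 Proposition p. 57 (27)] -/
theorem cruxOnEpCorner_of_BT (hBT : burungaleTian_analyticRank_eq_zero_of_selmerCorank_eq_zero_of_hasCM) :
    ∀ (p : ℕ) [Fact p.Prime] [(congruentNumberCurve p).IsElliptic] [(congruentNumberCurve p).IsGloballyMinimal]
      [NeZero ((congruentNumberCurve p).conductorNorm ℤ)],
      p % 8 = 7 →
      (p % 3 = 2 ∨ p % 5 = 2 ∨ p % 5 = 3 ∨ jacobiSym (p : ℤ) 11 = -1 ∨ jacobiSym (p : ℤ) 19 = -1 ∨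
        jacobiSym (p : ℤ) 43 = -1 ∨ jacobiSym (13 : ℤ) p = -1) →
      ∃ (K : Type) (_ : Field K) (_ : NumberField K),
        IsImaginaryQuadratic K ∧ 4 < (NumberField.discr K).natAbs ∧
        SatisfiesHeegnerHypothesis ((congruentNumberCurve p).conductorNorm ℤ) K ∧
        ((congruentNumberCurve p).quadraticTwist (NumberField.discr K : ℚ)).entireLFunction 1 ≠ 0 ∧
        NumberField.classNumber K < p ∧ ¬ p ∣ NumberField.classNumber K := by
  intro p hpF _ _ _ hp8 hcase
  have hp : p.Prime := hpF.out
  have hp4 : p % 4 = 3 := by omega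
  obtain ⟨q, l, hq, hq8, hl, hl8, hJq, hJl, hh⟩ := exists_cellData_p hp hp8 hcase
  obtain ⟨K, iF, iN, hK, hdK, hH', hcl⟩ := exists_witnessField_of (N := (congruentNumberCurve p).conductorNorm ℤ)
    hq hq8 hl hl8 (jacobiSym_neg_mul_eq_one hp4 hJq hJl) hh (fun r hr hrN => eq_two_or_eq_of_prime_dvd_conductorNorm_p hp hr hrN)
  refine ⟨K, iF, iN, hK, ?_, hH', ?_, hcl, fun hdvd => absurd (Nat.le_of_dvd (NumberField.classNumber_pos K) hdvd) (not_le.mpr hcl)⟩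
  · rw [hdK, Int.natAbs_neg, Int.natAbs_natCast]
    have h3 : 3 ≤ q := by have := hq.two_le; omega
    have h5 : 5 ≤ l := by have := hl.two_le; omega
    calc 4 < 3 * 5 := by norm_num
      _ ≤ q * l := Nat.mul_le_mul h3 h5
  · rw [hdK, quadraticTwist_congruentNumberCurve, Int.natAbs_neg, Int.natAbs_natCast, ← mul_assoc]
    haveI := isElliptic_congruentNumberCurve (Nat.mul_ne_zero (Nat.mul_ne_zero hp.ne_zero hq.ne_zero) hl.ne_zero)
    exact (L_one_ne_zero_congruent hBT hp hq hl hp8 hq8 hl8 hJq hJl).2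

end Corner

end Summit.BirchSwinnertonDyer.BirchSwinnertonDyer.Theorems.BiquadraticEisensteinDescentHeegnerTwistCouplingInSupplyCornersEpOneFact

end
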